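import Summits.AtomisticToContinuum.HydrodynamicLimit.Theses.JeansLoadedDice
import Summits.AtomisticToContinuum.HydrodynamicLimit.Theorems.OneFlightGossipEngineEnergyCurrentTailsEnergyFluxCeilingOneRareDockPrelim
import HarnessLib

/-!
# Crux `EnergyCurrentTails` (stmt-AtomisticToContinuum-9235), line `quartic-schur-ledger`:
# the bulk energy-flux ceiling S2a″ from the one-rare-participant contact-intensity ceiling
# (stmt-AtomisticToContinuum-16939)

Docking of the line's all-windows energy-flux ceiling S2a″ (`stub_energyFluxCeilingWindows`, open
primitive of the line) onto the shared item `JeansLoadedDice.ContactIntensityDominationOneRare`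
(stmt-16939): `stub_energyFluxCeilingWindows_of_oneRare`.  Instantiate the one-rare-participant
ceiling at the continuous mark `ψ(v) = ofReal ‖v‖²`, `k = 2`; on the conull good set the line's real
collision sum of `‖v₁⁻‖²‖v₂⁻‖²` is dominated by the routes' `∑ᶠ` form of `ψ(v₁⁻)(1+‖v₂⁻‖)²`
(`c5dock_ofReal_collisionSum_le_finsum`); on the Boltzmann–Enskog side
`‖v‖²(1+‖w‖)²‖v − w‖ ≤ 4(‖v‖³ + ‖v‖³‖w‖² + ‖w‖³ + ‖v‖²‖w‖³)` and Tonelli over the two independent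
copies give `8 (N+1)² m₃ (1 + m₂)` (`c5dock_double_sum_le_avg`); the constant `1` is absorbed into
`m₂` by the uniform lower bound `m₂(r) ≥ 3 min θ₀ =: μ₂` (`c5dock_secondMoment_lower`: energy
conservation on the good set and the Gaussian disintegration of the local Gibbs datum, for
`σ ≤ 1/2`), whence S2a″ with `σ₀ := min σ₀(γ) (1/2)`, `C := 8 (μ₂⁻¹ + 1) · C(γ).toReal` and the `N₀`
of (γ).
-/

noncomputable section

open MeasureTheory Set Filter
open scoped ENNReal InnerProductSpace

namespace Summit.AtomisticToContinuum.HydrodynamicLimit.Theorems.QuarticSchurLedger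

open Literature.MathematicalPhysics.KineticTheory Literature.Analysis.FluidPDE

section Main

/-- The real-analytic identity of the docking: the clock and the normalisations combine to
`(N+1)⁻¹ · c · (σ²(N+1)^{1/3}/(N+1)) · (s′−s) · (N+1)² · K = K c σ²(N+1)^{1/3}(s′−s)`. [folklore] -/
theorem c5dock_clock_identity (N : ℕ) (σ c K s s' : ℝ) :
    ((N : ℝ) + 1)⁻¹ * c * (σ ^ 2 * ((N : ℝ) + 1) ^ (1 / 3 : ℝ) / ((N : ℝ) + 1)) * (s' - s) *
        (((N : ℝ) + 1) * ((N : ℝ) + 1)) * K =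
      K * c * (σ ^ 2 * ((N : ℝ) + 1) ^ (1 / 3 : ℝ) * (s' - s)) := by
  have hN : (N : ℝ) + 1 ≠ 0 := by positivity
  field_simp

/-- **Stub S2a″-dock — S2a″ FROM THE SHARED ONE-RARE-PARTICIPANT CEILING stmt-16939** (registered
glue stub of the line `quartic-schur-ledger`, crux stmt-AtomisticToContinuum-9235
`EnergyCurrentTails`).  `JeansLoadedDice.ContactIntensityDominationOneRare → S2a″`: instantiate (γ)
at `ψ(v) = ofReal ‖v‖²` (continuous), `k = 2`, horizon `T`, with `σ₀ := min σ₀(γ) (1/2)`; on the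
conull good set the line's real collision sum of `‖v₁⁻‖²‖v₂⁻‖²` is dominated by the route's `∑ᶠ`
form of the mark `ψ(v₁⁻)(1+‖v₂⁻‖)²` (`c5dock_ofReal_collisionSum_le_finsum`); on the right
`‖v‖²(1+‖w‖)²‖v−w‖ ≤ 4(‖v‖³ + ‖v‖³‖w‖² + ‖w‖³ + ‖v‖²‖w‖³)` and Tonelli over the two copies give
`8(N+1)² m₃(1 + m₂)` (`c5dock_double_sum_le_avg`), and the uniform lower bound
`m₂(r) ≥ 3 min θ₀ =: μ₂` (`c5dock_secondMoment_lower`: energy conservation + Gaussian datum)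
absorbs the constant, `1 + m₂ ≤ (μ₂⁻¹ + 1) m₂`; whence S2a″ with `C := 8(μ₂⁻¹ + 1) · C(γ).toReal`
and the `N₀` of (γ). -/
theorem stub_energyFluxCeilingWindows_of_oneRare :
    Summit.AtomisticToContinuum.HydrodynamicLimit.Theses.JeansLoadedDice.ContactIntensityDominationOneRare →
    ∀ (a₀ θ₀ : T3 → ℝ) (u₀ : T3 → V3), Continuous a₀ → Continuous θ₀ → Continuous u₀ →
      (∀ x, 0 < a₀ x) → (∀ x, 0 < θ₀ x) →
      ∃ σ₀ : ℝ, 0 < σ₀ ∧ ∀ σ : ℝ, 0 < σ → σ < σ₀ → ∀ T : ℝ, 0 < T →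
        ∀ Φ : ((N : ℕ) → HardSphereFlow (Torus.geometry (Fin 3)) (hsDiameter σ N) (N + 1)),
          ∃ C : ℝ, 0 ≤ C ∧ ∃ N₀ : ℕ, ∀ N : ℕ, N₀ ≤ N → ∀ s s' : ℝ, 0 ≤ s → s ≤ s' → s' ≤ T →
            (∫⁻ z, ENNReal.ofReal (((N : ℝ) + 1)⁻¹ *
                (Φ N).collisionSum (Set.Ioc s s')
                  (fun col => ‖col.preVel.1‖ ^ 2 * ‖col.preVel.2‖ ^ 2) z)
              ∂(localGibbsLaw σ a₀ u₀ θ₀ N (Φ N)))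
            ≤ ENNReal.ofReal (C * (σ ^ 2 * ((N : ℝ) + 1) ^ (1 / 3 : ℝ) * (s' - s))) *
                (⨆ r ∈ Set.Icc s s',
                  (∫⁻ z, ENNReal.ofReal (((N : ℝ) + 1)⁻¹ *
                      ∑ i : Fin (N + 1), ‖((Φ N).flow r z i).2‖ ^ 2)
                    ∂(localGibbsLaw σ a₀ u₀ θ₀ N (Φ N)))) *
                (⨆ r ∈ Set.Icc s s',
                  (∫⁻ z, ENNReal.ofReal (((N : ℝ) + 1)⁻¹ *
                      ∑ i : Fin (N + 1), ‖((Φ N).flow r z i).2‖ ^ 3)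
                    ∂(localGibbsLaw σ a₀ u₀ θ₀ N (Φ N)))) := by
  intro hOR a₀ θ₀ u₀ ha hθ hu ha0 hθ0
  -- the minimum of the temperature profile on the compact torus
  obtain ⟨xm, -, hxm⟩ := isCompact_univ.exists_isMinOn univ_nonempty hθ.continuousOn
  have hmin : ∀ y, θ₀ xm ≤ θ₀ y := fun y => hxm (mem_univ y)
  have hθm : 0 < θ₀ xm := hθ0 xm
  set μ₂ : ℝ := 3 * θ₀ xm with hμ₂
  have hμ₂0 : 0 < μ₂ := by positivity
  set K : ℝ := 8 * (μ₂⁻¹ + 1) with hKdef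
  have hK0 : 0 ≤ K := by positivity
  have hK8 : (8 : ℝ≥0∞) * (ENNReal.ofReal (μ₂⁻¹) + 1) = ENNReal.ofReal K := by
    rw [hKdef, ENNReal.ofReal_mul (by norm_num), ENNReal.ofReal_add (by positivity) zero_le_one,
      ENNReal.ofReal_one, ENNReal.ofReal_ofNat]
  -- the one-rare-participant ceiling for the profiles
  obtain ⟨σ₁, hσ₁, H⟩ := hOR a₀ θ₀ u₀ ha hθ hu ha0 hθ0
  refine ⟨min σ₁ (1 / 2), lt_min hσ₁ (by norm_num), fun σ hσ hσlt T hT Φ => ?_⟩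
  have hσ1 : σ < σ₁ := lt_of_lt_of_le hσlt (min_le_left _ _)
  have hσ2 : σ ≤ 1 / 2 := (lt_of_lt_of_le hσlt (min_le_right _ _)).le
  obtain ⟨C, hC, N₀, HN⟩ := H σ hσ hσ1 T hT Φ
  refine ⟨K * C.toReal, mul_nonneg hK0 ENNReal.toReal_nonneg, N₀, fun N hN s s' hs0 hss' hs'T => ?_⟩
  have hN1 : (0 : ℝ) < (N : ℝ) + 1 := by positivity
  -- the law (a probability measure), the mark, the key inequality
  set μ : Measure (Config (N + 1) (Fin 3) T3) := localGibbsLaw σ a₀ u₀ θ₀ N (Φ N) with hμ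
  haveI : IsProbabilityMeasure μ := isProbabilityMeasure_localGibbsLaw ha hθ hu ha0 hθ0 hσ2 N (Φ N)
  set ψ : V3 → ℝ≥0∞ := fun v => ENNReal.ofReal (‖v‖ ^ 2) with hψdef
  have hψc : Continuous ψ := by
    rw [hψdef]
    exact ENNReal.continuous_ofReal.comp (continuous_norm.pow 2)
  have key := HN N hN s s' hs0 hss' hs'T 2 (by norm_num) ψ hψc
  -- (1) the LEFT side: bridge + termwise domination, a.e. on the good set
  have hLHS : (∫⁻ z, ENNReal.ofReal (((N : ℝ) + 1)⁻¹ *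
        (Φ N).collisionSum (Set.Ioc s s')
          (fun col => ‖col.preVel.1‖ ^ 2 * ‖col.preVel.2‖ ^ 2) z) ∂μ) ≤
      ENNReal.ofReal (((N : ℝ) + 1)⁻¹) *
        ∫⁻ z, (∑ᶠ τ' ∈ collisionTimes (Torus.geometry (Fin 3)) (hsDiameter σ N)
            (fun r => (Φ N).flow r z) ∩ Set.Ioc s s',
          ∑ i : Fin (N + 1), ∑ j : Fin (N + 1), if i = j then (0 : ℝ≥0∞) else
            (contactSet (Torus.geometry (Fin 3)) (N + 1) (hsDiameter σ N) i j).indicator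
              (fun y => (fun p : V3 × V3 => ψ p.1 * ENNReal.ofReal ((1 + ‖p.2‖) ^ 2))
                ((((collidePair (Torus.geometry (Fin 3)) i j y)) i).2,
                  (((collidePair (Torus.geometry (Fin 3)) i j y)) j).2)) ((Φ N).flow τ' z)) ∂μ := by
    rw [← lintegral_const_mul' _ _ ENNReal.ofReal_ne_top]
    refine lintegral_mono_ae ?_
    filter_upwards [ae_mem_good_localGibbsLaw σ a₀ u₀ θ₀ N (Φ N)] with z hz
    rw [ENNReal.ofReal_mul (by positivity)]
    exact mul_le_mul_right (c5dock_ofReal_collisionSum_le_finsum (Φ N) hz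
      Set.Ioc_subset_Icc_self ψ (fun v w => by rw [hψdef]; exact c5dock_sq_mul_sq_le v w)) _
  -- (2) the RIGHT side: Tonelli + the lower bound on `m₂` + window sups
  set S₂ : ℝ≥0∞ := ⨆ r ∈ Set.Icc s s', (∫⁻ z, ENNReal.ofReal (((N : ℝ) + 1)⁻¹ *
      ∑ i : Fin (N + 1), ‖((Φ N).flow r z i).2‖ ^ 2) ∂μ) with hS₂
  set S₃ : ℝ≥0∞ := ⨆ r ∈ Set.Icc s s', (∫⁻ z, ENNReal.ofReal (((N : ℝ) + 1)⁻¹ *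
      ∑ i : Fin (N + 1), ‖((Φ N).flow r z i).2‖ ^ 3) ∂μ) with hS₃
  have hinner : ∀ r ∈ Set.Ioc s s',
      (∫⁻ z, ∫⁻ z', ∑ i : Fin (N + 1), ∑ j : Fin (N + 1),
          ψ ((Φ N).flow r z i).2 * ENNReal.ofReal ((1 + ‖((Φ N).flow r z' j).2‖) ^ 2) *
            ENNReal.ofReal ‖((Φ N).flow r z i).2 - ((Φ N).flow r z' j).2‖ ∂μ ∂μ) ≤
        ENNReal.ofReal (((N : ℝ) + 1) * ((N : ℝ) + 1)) * (ENNReal.ofReal K * (S₂ * S₃)) := by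
    intro r hr
    have hrI : r ∈ Set.Icc s s' := Set.Ioc_subset_Icc_self hr
    have h2 : (∫⁻ z, ENNReal.ofReal (((N : ℝ) + 1)⁻¹ *
        ∑ i : Fin (N + 1), ‖((Φ N).flow r z i).2‖ ^ 2) ∂μ) ≤ S₂ := by
      rw [hS₂]; exact le_iSup₂_of_le r hrI le_rfl
    have h3 : (∫⁻ z, ENNReal.ofReal (((N : ℝ) + 1)⁻¹ *
        ∑ i : Fin (N + 1), ‖((Φ N).flow r z i).2‖ ^ 3) ∂μ) ≤ S₃ := by
      rw [hS₃]; exact le_iSup₂_of_le r hrI le_rfl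
    have hlow : ENNReal.ofReal μ₂ ≤ (∫⁻ z, ENNReal.ofReal (((N : ℝ) + 1)⁻¹ *
        ∑ i : Fin (N + 1), ‖((Φ N).flow r z i).2‖ ^ 2) ∂μ) :=
      c5dock_secondMoment_lower a₀ θ₀ u₀ ha hθ hu ha0 hθ0 _ hmin σ hσ2 N (Φ N) r
    have hone : (1 : ℝ≥0∞) ≤ ENNReal.ofReal (μ₂⁻¹) * (∫⁻ z, ENNReal.ofReal (((N : ℝ) + 1)⁻¹ *
        ∑ i : Fin (N + 1), ‖((Φ N).flow r z i).2‖ ^ 2) ∂μ) :=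
      calc (1 : ℝ≥0∞) = ENNReal.ofReal (μ₂⁻¹ * μ₂) := by
            rw [inv_mul_cancel₀ hμ₂0.ne', ENNReal.ofReal_one]
        _ = ENNReal.ofReal (μ₂⁻¹) * ENNReal.ofReal μ₂ := ENNReal.ofReal_mul (by positivity)
        _ ≤ _ := mul_le_mul_right hlow _
    calc (∫⁻ z, ∫⁻ z', ∑ i : Fin (N + 1), ∑ j : Fin (N + 1),
          ψ ((Φ N).flow r z i).2 * ENNReal.ofReal ((1 + ‖((Φ N).flow r z' j).2‖) ^ 2) *
            ENNReal.ofReal ‖((Φ N).flow r z i).2 - ((Φ N).flow r z' j).2‖ ∂μ ∂μ)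
        ≤ ENNReal.ofReal (((N : ℝ) + 1) * ((N : ℝ) + 1)) *
            (8 * ((∫⁻ z, ENNReal.ofReal (((N : ℝ) + 1)⁻¹ *
                ∑ i : Fin (N + 1), ‖((Φ N).flow r z i).2‖ ^ 3) ∂μ) *
              (1 + ∫⁻ z, ENNReal.ofReal (((N : ℝ) + 1)⁻¹ *
                ∑ i : Fin (N + 1), ‖((Φ N).flow r z i).2‖ ^ 2) ∂μ))) := by
          rw [hψdef]; exact c5dock_double_sum_le_avg (Φ N) μ r
      _ ≤ ENNReal.ofReal (((N : ℝ) + 1) * ((N : ℝ) + 1)) *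
            (8 * ((∫⁻ z, ENNReal.ofReal (((N : ℝ) + 1)⁻¹ *
                ∑ i : Fin (N + 1), ‖((Φ N).flow r z i).2‖ ^ 3) ∂μ) *
              (ENNReal.ofReal (μ₂⁻¹) * (∫⁻ z, ENNReal.ofReal (((N : ℝ) + 1)⁻¹ *
                  ∑ i : Fin (N + 1), ‖((Φ N).flow r z i).2‖ ^ 2) ∂μ) +
                ∫⁻ z, ENNReal.ofReal (((N : ℝ) + 1)⁻¹ *
                  ∑ i : Fin (N + 1), ‖((Φ N).flow r z i).2‖ ^ 2) ∂μ))) := by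
          gcongr
      _ = ENNReal.ofReal (((N : ℝ) + 1) * ((N : ℝ) + 1)) *
            ((8 * (ENNReal.ofReal (μ₂⁻¹) + 1)) *
              ((∫⁻ z, ENNReal.ofReal (((N : ℝ) + 1)⁻¹ *
                  ∑ i : Fin (N + 1), ‖((Φ N).flow r z i).2‖ ^ 2) ∂μ) *
                (∫⁻ z, ENNReal.ofReal (((N : ℝ) + 1)⁻¹ *
                  ∑ i : Fin (N + 1), ‖((Φ N).flow r z i).2‖ ^ 3) ∂μ))) := by
          ring
      _ ≤ ENNReal.ofReal (((N : ℝ) + 1) * ((N : ℝ) + 1)) * (ENNReal.ofReal K * (S₂ * S₃)) := by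
          rw [hK8]; gcongr
  have hRHS : (∫⁻ r in Set.Ioc s s', ∫⁻ z, ∫⁻ z', ∑ i : Fin (N + 1), ∑ j : Fin (N + 1),
        ψ ((Φ N).flow r z i).2 * ENNReal.ofReal ((1 + ‖((Φ N).flow r z' j).2‖) ^ 2) *
          ENNReal.ofReal ‖((Φ N).flow r z i).2 - ((Φ N).flow r z' j).2‖ ∂μ ∂μ) ≤
      ENNReal.ofReal (s' - s) *
        (ENNReal.ofReal (((N : ℝ) + 1) * ((N : ℝ) + 1)) * (ENNReal.ofReal K * (S₂ * S₃))) := by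
    calc (∫⁻ r in Set.Ioc s s', ∫⁻ z, ∫⁻ z', ∑ i : Fin (N + 1), ∑ j : Fin (N + 1),
          ψ ((Φ N).flow r z i).2 * ENNReal.ofReal ((1 + ‖((Φ N).flow r z' j).2‖) ^ 2) *
            ENNReal.ofReal ‖((Φ N).flow r z i).2 - ((Φ N).flow r z' j).2‖ ∂μ ∂μ)
        ≤ ∫⁻ _r in Set.Ioc s s',
            ENNReal.ofReal (((N : ℝ) + 1) * ((N : ℝ) + 1)) * (ENNReal.ofReal K * (S₂ * S₃)) :=
          setLIntegral_mono' measurableSet_Ioc fun r hr => hinner r hr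
      _ = _ := by
          rw [setLIntegral_const, Real.volume_Ioc, mul_comm]
  -- (3) assemble
  have hC' : C = ENNReal.ofReal C.toReal := (ENNReal.ofReal_toReal hC.ne).symm
  have hcast : ((N + 1 : ℕ) : ℝ) = (N : ℝ) + 1 := by push_cast; ring
  have hds : 0 ≤ s' - s := sub_nonneg.2 hss'
  have hx1 : (0 : ℝ) ≤ ((N : ℝ) + 1)⁻¹ := by positivity
  have hprod : ENNReal.ofReal (((N : ℝ) + 1)⁻¹) * ENNReal.ofReal C.toReal *
      ENNReal.ofReal (σ ^ 2 * ((N : ℝ) + 1) ^ (1 / 3 : ℝ) / ((N : ℝ) + 1)) *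
        ENNReal.ofReal (s' - s) * ENNReal.ofReal (((N : ℝ) + 1) * ((N : ℝ) + 1)) *
          ENNReal.ofReal K =
      ENNReal.ofReal (K * C.toReal * (σ ^ 2 * ((N : ℝ) + 1) ^ (1 / 3 : ℝ) * (s' - s))) := by
    rw [← ENNReal.ofReal_mul hx1, ← ENNReal.ofReal_mul (by positivity),
      ← ENNReal.ofReal_mul (by positivity), ← ENNReal.ofReal_mul (by positivity),
      ← ENNReal.ofReal_mul (by positivity), c5dock_clock_identity]
  calc (∫⁻ z, ENNReal.ofReal (((N : ℝ) + 1)⁻¹ *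
        (Φ N).collisionSum (Set.Ioc s s')
          (fun col => ‖col.preVel.1‖ ^ 2 * ‖col.preVel.2‖ ^ 2) z) ∂μ)
      ≤ _ := hLHS
    _ ≤ ENNReal.ofReal (((N : ℝ) + 1)⁻¹) * (C * ENNReal.ofReal (σ ^ 2 *
          ((N + 1 : ℕ) : ℝ) ^ ((1 : ℝ) / 3) / ((N + 1 : ℕ) : ℝ)) *
            (ENNReal.ofReal (s' - s) *
              (ENNReal.ofReal (((N : ℝ) + 1) * ((N : ℝ) + 1)) *
                (ENNReal.ofReal K * (S₂ * S₃))))) := by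
        gcongr
        exact key.trans (mul_le_mul_right hRHS _)
    _ = ENNReal.ofReal (K * C.toReal * (σ ^ 2 * ((N : ℝ) + 1) ^ (1 / 3 : ℝ) * (s' - s))) *
          S₂ * S₃ := by
        rw [hcast, show ((1 : ℝ) / 3) = (1 / 3 : ℝ) from rfl, ← hprod]
        nth_rewrite 1 [hC']
        ring

end Main

end Summit.AtomisticToContinuum.HydrodynamicLimit.Theorems.QuarticSchurLedger

end
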